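import Literature.AnabelianGeometry.EtaleTheta.Discharge.Sec5RootOfRootModel

/-!
# [EtTh] Rmk. 4.3.2 at the canonical model: the TRANSITION `(α_{N,N′}, β_{N,N′})` from an `N′`-th root to an `N`-th root
# over a GIVEN pull-back covering with compatible roots — «one verifies immediately»

Mochizuki, *The étale theta function and its Frobenioid-theoretic manifestations*, Publ. RIMS **45** (2009), Rmk. 4.3.2
pp. 318–319 (PDF pp. 92–93): «if `N` divides `N′` … given an `N`-th root of the fraction-pair `(s′, s″)` …, there exists a
"morphism" from a suitable `N′`-th root of the fraction-pair `(s′, s″)` … to the given `N`-th root …, i.e., a pair of commutative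
diagrams [`s′_{N′} ≫ β_{N,N′} = α_{N,N′} ≫ s′_N`, `s″_{N′} ≫ β_{N,N′} = α_{N,N′} ≫ s″_N`] — where `α_{N,N′}` (respectively, `β_{N,N′}`)
is an isometry of Frobenius degree `N′/N` that is compatible with `α′, α` (respectively, `β′, β`); `α_{N,N′}` is of base-Frobenius
type» [cite: MochizukiEtTh2009, Rmk 4.3.2 p.318 (PDF p.92)]; «by allowing `N` to vary, we obtain a compatible system of roots»
(p. 319).

abc-iut cell, layer L2, PROOF-ONLY companion (0 `def`s; seat abc-iut-w5-d134 gen 4) of `Discharge/Sec5RootOfRootModel.lean`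
(p433723) and of abc-iut-L2-t4's tower assembly `FrobenioidThetaTowerOfBiKummerFamily.lean` (p420398), whose Rmk. 4.3.2
transition INPUTS `α`, `β`, `comm_sCap`, `comm_sCup`, `isIsometry_α/β`, `degFr_α/β`, `baseFrob_α` are PRODUCED here for any two root
data related by a pull-back covering over which the roots are compatible (`f_{N′}^{N′/N} = φ^* f_N`) — print's situation
(`Z̈_{l·N′} → Z̈_{l·N}`, `s_{l·N}|_{Z̈_{l·N′}} = s_{l·N′}^{N′/N}`).  No saturation or fixedness input: a transition is NOT an
`(N′/N)`-th-root STRUCTURE over `A_N` (that would demand `H_{A_{N′}}`-fixedness of `φ^* f_N`, false in print for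
`f_N = Θ̈^{1/(l·N)}`); only the isometries and the two squares are produced.  Nothing landed is edited or restated.

* `exists_rootTransition_of_cover_mkOfModelCanonical` — for a Frobenius-trivial `A` with Galois base, `f ∈ O^×(A^birat)` with a
  right fraction-pair `P = (s, τ) : A → B`, a pull-back morphism `φ : A′ → A` from a Frobenius-trivial Galois `μ_M`-saturated `A′`
  with `A′ = A` whenever `A′^bs ≅ A^bs`, `g ∈ O^×(A′^birat)` with `g^M = φ^* f` and a right fraction-pair `Q = (s′, τ′) : A′ → B′` of
  `g` with `M·Div(s′) = φ^*Div(s)`, `M·Div(τ′) = φ^*Div(τ)`: isometries `α : A′ → A` (of base-Frobenius type, pull-back part over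
  `Base φ`) and `β : B′ → B` of Frobenius degree `M` with `s′ ≫ β = α ≫ s`, `τ′ ≫ β = α ≫ τ` (L03′/L04 transported from the instance
  `mkOfModelCanonical … (A₀ := A) …`, as in p433723).
* `exists_rootTransition_of_nthRoots_mkOfModelCanonical` — for an `N`-th root datum `R` and an `M·N`-th root datum `R′` of the
  SAME fraction-pair (any domain) together with a pull-back morphism `φ : A_{M·N} → A_N` over `Base(α′_{M·N}) = Base φ ≫ Base(α′_N)`,
  compatible roots `f_{M·N}^M = φ^* f_N` and the skeleton clause: the Rmk. 4.3.2 transition in the FIELD SHAPES of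
  `ThetaFrobenioidTower.ofBiKummerFamily` (`α`, `β`, the two squares, isometries, `deg_Fr · N = M·N`, `IsOfBaseFrobeniusType α`); the
  divisor bookkeeping `M·Div(s′_{M·N}) = φ^*Div(s′_N)` is derived from the two root squares and the perfection of `Φ`.

HONEST FRAMING: kernel-checked for data so typed, modulo `Φ` divisorial; nothing asserts that such data exist for an actual curve;
no side is taken on [IUTchIII] Cor. 3.12.
-/

noncomputable section

namespace Literature.AnabelianGeometry.EtaleTheta

open CategoryTheory Opposite Literature.AlgebraicGeometry.Frobenioids

universe u₀ v₀ u v w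

namespace BiKummerSetting

section Canonical

variable {K : Type u₀} [Field K] (X : SemiGraphs.TemperedArithmeticGroup.{u₀} K) {D₀ : Type u₀}
  [Category.{v₀} D₀] {V : FrdIMonoidStub.{w}} {T : RealifiedDivisorMonoids (D₀ := D₀) V}
  {D : Type u} [Category.{v} D] {VD : FrdICatStub.{u, v, w} D}
  (tf : TemperedFrobenioid T D VD) (hZ : tf.monoidType = MonoidType.Z)
  (hP : ∀ A : Dᵒᵖ, IsPerfect (tf.Φ.carrier A)) (IG : D → Prop) (gS : ∀ A : D, IG A → (X.Pi →* Aut A))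
  (gSs : ∀ (A : D) (h : IG A), Function.Surjective (gS A h))
  (NH : Subgroup (Field.absoluteGaloisGroup K) → tf.category → ℕ+ → Prop) (A₀ : tf.category)
  (hA₀ : PreFrobenioid.IsFrobeniusTrivial tf.toElem A₀) (hA₀' : IG A₀.base)
  (hΦd : Objectwise (fun M _ => IsDivisorial M) tf.divisorMonoid)

include hΦd in
/-- **The Rmk. 4.3.2 transition over a GIVEN covering with compatible root and sections** (no saturation, no fixedness): see the
module docstring.  `α := F(M)_{A′} ≫ φ′`, `φ′` the `P`-arrow over `Base φ` of the model's base-Frobenius pair through `A′` and `A`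
(L03′ in the instance with distinguished object `A`); `β` from the root squares L04 there.
[cite: MochizukiEtTh2009, Rmk 4.3.2 p.318–319 (PDF pp.92–93)] -/
theorem exists_rootTransition_of_cover_mkOfModelCanonical
    {A B : tf.category} (hAft : PreFrobenioid.IsFrobeniusTrivial tf.toElem A) (hAG : IG A.base)
    {f : tf.biratUnitsModel A} (P : (mkOfModelCanonical X tf hZ hP IG gS gSs NH A₀ hA₀ hA₀').FractionPair f B) (M : ℕ+)
    {AN BN : tf.category} (φ : AN ⟶ A) (hφ : PreFrobenioid.IsPullbackMorphism tf.toElem φ)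
    (hft : PreFrobenioid.IsFrobeniusTrivial tf.toElem AN) (hG : IG AN.base)
    (hsk₁ : Nonempty (AN.base ≅ A.base) → AN = A) (hμM : tf.IsMuSaturated AN M)
    {gN : tf.biratUnitsModel AN} (hgN : gN ^ (M : ℕ) = tf.pullFracModel φ f)
    (Q : (mkOfModelCanonical X tf hZ hP IG gS gSs NH A₀ hA₀ hA₀').FractionPair gN BN)
    (hQn : ModelFrobenioid.div Q.num ^ (M : ℕ) =
      pull tf.divisorMonoid (ModelFrobenioid.baseMap φ) (ModelFrobenioid.div P.num))
    (hQd : ModelFrobenioid.div Q.den ^ (M : ℕ) =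
      pull tf.divisorMonoid (ModelFrobenioid.baseMap φ) (ModelFrobenioid.div P.den)) :
    ∃ (α : AN ⟶ A) (β : BN ⟶ B) (d : (mkOfModelCanonical X tf hZ hP IG gS gSs NH A₀ hA₀ hA₀').BaseFrobeniusTypeData α),
      (mkOfModelCanonical X tf hZ hP IG gS gSs NH A₀ hA₀ hA₀').IsIsometry α ∧
        (mkOfModelCanonical X tf hZ hP IG gS gSs NH A₀ hA₀ hA₀').IsIsometry β ∧
          (mkOfModelCanonical X tf hZ hP IG gS gSs NH A₀ hA₀ hA₀').degFr α = M ∧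
            (mkOfModelCanonical X tf hZ hP IG gS gSs NH A₀ hA₀ hA₀').degFr β = M ∧
              Q.num ≫ β = α ≫ P.num ∧ Q.den ≫ β = α ≫ P.den ∧
                ModelFrobenioid.baseMap d.α₁ = ModelFrobenioid.baseMap φ ∧ gN ^ (M : ℕ) = tf.pullFracModel d.α₁ f := by
  -- L03′ in the instance with distinguished object `A`: the base-Frobenius-type lift of `φ` up to a unit
  obtain ⟨s, hs, α, dA, hd, hiso, hdeg⟩ := Prop42Sub.baseFrobeniusLiftUpToUnit_mkOfModelCanonical X tf hZ hP IG gS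
    gSs NH A hAft hAG hΦd M AN φ hsk₁ hφ hft hG hμM
  have hb₁ : ModelFrobenioid.baseMap dA.α₁ = ModelFrobenioid.baseMap φ := by
    have hb : ModelFrobenioid.baseMap s.hom = 𝟙 _ := hs.1
    have h0 : ModelFrobenioid.baseMap dA.α₁ = ModelFrobenioid.baseMap (s.hom ≫ φ) :=
      congrArg ModelFrobenioid.baseMap hd
    rw [h0, ModelFrobenioid.baseMap_comp, hb, Category.id_comp]
  have hpf : tf.pullFracModel dA.α₁ f = tf.pullFracModel φ f :=
    DFunLike.congr_fun (tf.pullFracModel_eq_of_baseMap_eq hb₁) f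
  have hgN' : gN ^ (M : ℕ) = tf.pullFracModel dA.α₁ f := by
    rw [hpf]
    exact hgN
  have hQn' : ModelFrobenioid.div Q.num ^ (M : ℕ) =
      pull tf.divisorMonoid (ModelFrobenioid.baseMap dA.α₁) (ModelFrobenioid.div P.num) := by
    rw [hb₁]
    exact hQn
  have hQd' : ModelFrobenioid.div Q.den ^ (M : ℕ) =
      pull tf.divisorMonoid (ModelFrobenioid.baseMap dA.α₁) (ModelFrobenioid.div P.den) := by
    rw [hb₁]
    exact hQd
  -- L04 there (fraction-pairs carried field by field between the two instances of the same tempered Frobenioid)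
  obtain ⟨β, hβiso, hβdeg, hcn, hcd⟩ := rootSquares_mkOfModel tf hZ hP T.isUnit_BΛ _ IG gS gSs NH _ A hAft hAG f
    (⟨P.num, P.den, P.isPreStep_num, P.isPreStep_den, P.base_eq, P.frac_eq, P.disjointSupports⟩ :
      (mkOfModelCanonical X tf hZ hP IG gS gSs NH A hAft hAG).FractionPair f B)
    M AN α dA gN BN
    (⟨Q.num, Q.den, Q.isPreStep_num, Q.isPreStep_den, Q.base_eq, Q.frac_eq, Q.disjointSupports⟩ :
      (mkOfModelCanonical X tf hZ hP IG gS gSs NH A hAft hAG).FractionPair gN BN)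
    hiso hdeg hgN' hQn' hQd'
  exact ⟨α, β, ⟨dA.G, dA.G_le, dA.α₂, dA.α₁, dA.fac, dA.isFrobeniusTrivial, dA.isGalois, dA.isMuSaturated,
      dA.mapsIsomorphically, dA.cond_c, dA.cond_d, dA.cond_e⟩, hiso, hβiso, hdeg, hβdeg, hcn, hcd, hb₁, hgN'⟩

include hΦd in
/-- **The Rmk. 4.3.2 transition between two root data `R` (level `N`) and `R′` (level `M·N`) of the same fraction-pair, in the
field shapes of abc-iut-L2-t4's `ThetaFrobenioidTower.ofBiKummerFamily`** — given a pull-back morphism `φ : A_{M·N} → A_N` over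
which the pull-back parts compose (`Base(α′_{M·N}) = Base φ ≫ Base(α′_N)`), compatible roots `f_{M·N}^M = φ^* f_N`, and
`A_{M·N} = A_N` whenever their bases are isomorphic: `α : A_{M·N} → A_N` of base-Frobenius type and `β : B_{M·N} → B_N`, isometries
of Frobenius degree `M` (so `deg · N = M·N`), with `s′_{M·N} ≫ β = α ≫ s′_N`, `s″_{M·N} ≫ β = α ≫ s″_N`.  The divisor bookkeeping
`M·Div(s′_{M·N}) = φ^*Div(s′_N)` is DERIVED: both sides have the same `N`-th power `Base(α_{M·N})^*Div(s′)` by the root squares of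
`R′` and `R` (`NthRoot.div_num_pow`), and `Φ(A_{M·N}^bs)` is perfect.  [cite: MochizukiEtTh2009, Rmk 4.3.2 p.318–319 (PDF pp.92–93)] -/
theorem exists_rootTransition_of_nthRoots_mkOfModelCanonical
    {A B : tf.category} {f : tf.biratUnitsModel A}
    {P : (mkOfModelCanonical X tf hZ hP IG gS gSs NH A₀ hA₀ hA₀').FractionPair f B} {N M : ℕ+}
    (R : (mkOfModelCanonical X tf hZ hP IG gS gSs NH A₀ hA₀ hA₀').NthRoot f P N (fun {_} φ x => tf.pullFracModel φ x))
    (R' : (mkOfModelCanonical X tf hZ hP IG gS gSs NH A₀ hA₀ hA₀').NthRoot f P (M * N) (fun {_} φ x => tf.pullFracModel φ x))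
    (φ : R'.AN ⟶ R.AN) (hφ : PreFrobenioid.IsPullbackMorphism tf.toElem φ)
    (hb : ModelFrobenioid.baseMap R'.αData.α₁ = ModelFrobenioid.baseMap φ ≫ ModelFrobenioid.baseMap R.αData.α₁)
    (hg : R'.root ^ (M : ℕ) = tf.pullFracModel φ R.root)
    (hsk : Nonempty (R'.AN.base ≅ R.AN.base) → R'.AN = R.AN) :
    ∃ (α : R'.AN ⟶ R.AN) (β : R'.BN ⟶ R.BN),
      R'.pair.num ≫ β = α ≫ R.pair.num ∧ R'.pair.den ≫ β = α ≫ R.pair.den ∧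
        (mkOfModelCanonical X tf hZ hP IG gS gSs NH A₀ hA₀ hA₀').IsIsometry α ∧
          ((mkOfModelCanonical X tf hZ hP IG gS gSs NH A₀ hA₀ hA₀').degFr α : ℕ) * N = M * N ∧
            (mkOfModelCanonical X tf hZ hP IG gS gSs NH A₀ hA₀ hA₀').IsIsometry β ∧
              ((mkOfModelCanonical X tf hZ hP IG gS gSs NH A₀ hA₀ hA₀').degFr β : ℕ) * N = M * N ∧
                (mkOfModelCanonical X tf hZ hP IG gS gSs NH A₀ hA₀ hA₀').IsOfBaseFrobeniusType α ∧
                  ModelFrobenioid.baseMap α = ModelFrobenioid.baseMap φ := by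
  -- `μ_M`-saturation of `A_{M·N}` from `μ_{M·N}` (Def. 4.1 (iv)(a) for `α_{M·N}`, `deg α_{M·N} = M·N`)
  have hdeg' : (mkOfModelCanonical X tf hZ hP IG gS gSs NH A₀ hA₀ hA₀').degFr R'.α = M * N := R'.isIsometry.2.2.1
  have hμ' : tf.IsMuSaturated R'.AN (M * N) := by
    have h := R'.αData.isMuSaturated
    rw [hdeg'] at h
    exact h
  have hμM : tf.IsMuSaturated R'.AN M := hμ'.of_dvd (by rw [PNat.mul_coe]; exact Dvd.intro _ rfl)
  -- the divisor bookkeeping `M·Div(s′_{M·N}) = φ^*Div(s′_N)`: equal `N`-th powers in the perfect monoid `Φ(A_{M·N}^bs)`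
  have hinj : Function.Injective fun a : tf.Φ.carrier (op R'.AN.base) => a ^ (N : ℕ) :=
    ((hP (op R'.AN.base)).bijective_pow N N.pos).1
  have hbR' := NthRoot.baseMap_α_eq (S := mkOfModelCanonical X tf hZ hP IG gS gSs NH A₀ hA₀ hA₀')
    (pullFrac := fun {_ _} φ x => tf.pullFracModel φ x) R'
  have hbR := NthRoot.baseMap_α_eq (S := mkOfModelCanonical X tf hZ hP IG gS gSs NH A₀ hA₀ hA₀')
    (pullFrac := fun {_ _} φ x => tf.pullFracModel φ x) R
  have hbα : ModelFrobenioid.baseMap R'.α = ModelFrobenioid.baseMap φ ≫ ModelFrobenioid.baseMap R.α := by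
    rw [hbR', hbR, hb]
  have hn' := NthRoot.div_num_pow (S := mkOfModelCanonical X tf hZ hP IG gS gSs NH A₀ hA₀ hA₀')
    (pullFrac := fun {_ _} φ x => tf.pullFracModel φ x) R'
  have hd' := NthRoot.div_den_pow (S := mkOfModelCanonical X tf hZ hP IG gS gSs NH A₀ hA₀ hA₀')
    (pullFrac := fun {_ _} φ x => tf.pullFracModel φ x) R'
  have hn := NthRoot.div_num_pow (S := mkOfModelCanonical X tf hZ hP IG gS gSs NH A₀ hA₀ hA₀')
    (pullFrac := fun {_ _} φ x => tf.pullFracModel φ x) R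
  have hd := NthRoot.div_den_pow (S := mkOfModelCanonical X tf hZ hP IG gS gSs NH A₀ hA₀ hA₀')
    (pullFrac := fun {_ _} φ x => tf.pullFracModel φ x) R
  have hQn : ModelFrobenioid.div R'.pair.num ^ (M : ℕ) =
      pull tf.divisorMonoid (ModelFrobenioid.baseMap φ) (ModelFrobenioid.div R.pair.num) := by
    apply hinj
    change (ModelFrobenioid.div R'.pair.num ^ (M : ℕ)) ^ (N : ℕ) =
      pull tf.divisorMonoid (ModelFrobenioid.baseMap φ) (ModelFrobenioid.div R.pair.num) ^ (N : ℕ)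
    calc (ModelFrobenioid.div R'.pair.num ^ (M : ℕ)) ^ (N : ℕ)
        = ModelFrobenioid.div R'.pair.num ^ ((M * N : ℕ+) : ℕ) := by rw [← pow_mul, PNat.mul_coe]
      _ = pull tf.divisorMonoid (ModelFrobenioid.baseMap φ)
            (pull tf.divisorMonoid (ModelFrobenioid.baseMap R.α) (ModelFrobenioid.div P.num)) := by
          rw [hn', hbα, pull_comp]
          rfl
      _ = pull tf.divisorMonoid (ModelFrobenioid.baseMap φ) (ModelFrobenioid.div R.pair.num ^ (N : ℕ)) :=
          congrArg (fun y => pull tf.divisorMonoid (ModelFrobenioid.baseMap φ) y) hn.symm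
      _ = pull tf.divisorMonoid (ModelFrobenioid.baseMap φ) (ModelFrobenioid.div R.pair.num) ^ (N : ℕ) := map_pow _ _ _
  have hQd : ModelFrobenioid.div R'.pair.den ^ (M : ℕ) =
      pull tf.divisorMonoid (ModelFrobenioid.baseMap φ) (ModelFrobenioid.div R.pair.den) := by
    apply hinj
    change (ModelFrobenioid.div R'.pair.den ^ (M : ℕ)) ^ (N : ℕ) =
      pull tf.divisorMonoid (ModelFrobenioid.baseMap φ) (ModelFrobenioid.div R.pair.den) ^ (N : ℕ)
    calc (ModelFrobenioid.div R'.pair.den ^ (M : ℕ)) ^ (N : ℕ)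
        = ModelFrobenioid.div R'.pair.den ^ ((M * N : ℕ+) : ℕ) := by rw [← pow_mul, PNat.mul_coe]
      _ = pull tf.divisorMonoid (ModelFrobenioid.baseMap φ)
            (pull tf.divisorMonoid (ModelFrobenioid.baseMap R.α) (ModelFrobenioid.div P.den)) := by
          rw [hd', hbα, pull_comp]
          rfl
      _ = pull tf.divisorMonoid (ModelFrobenioid.baseMap φ) (ModelFrobenioid.div R.pair.den ^ (N : ℕ)) :=
          congrArg (fun y => pull tf.divisorMonoid (ModelFrobenioid.baseMap φ) y) hd.symm
      _ = pull tf.divisorMonoid (ModelFrobenioid.baseMap φ) (ModelFrobenioid.div R.pair.den) ^ (N : ℕ) := map_pow _ _ _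
  obtain ⟨α, β, d, hiso, hβiso, hdeg, hβdeg, hcn, hcd, hb₁, -⟩ :=
    exists_rootTransition_of_cover_mkOfModelCanonical X tf hZ hP IG gS gSs NH A₀ hA₀ hA₀' hΦd R.αData.isFrobeniusTrivial
      R.αData.isGalois R.pair M φ hφ R'.αData.isFrobeniusTrivial R'.αData.isGalois hsk hμM hg R'.pair hQn hQd
  have hbα₁ : ModelFrobenioid.baseMap α = ModelFrobenioid.baseMap φ := by
    have hb₂ : ModelFrobenioid.baseMap d.α₂ = 𝟙 _ := d.cond_c.1
    have h := congrArg ModelFrobenioid.baseMap d.fac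
    rw [ModelFrobenioid.baseMap_comp, hb₂, Category.id_comp] at h
    rw [← h, hb₁]
  refine ⟨α, β, hcn, hcd, hiso, ?_, hβiso, ?_, ⟨d⟩, hbα₁⟩
  · rw [hdeg]
  · rw [hβdeg]


include hΦd in
/-- **The same transition for an `N′`-th root datum with `N ∣ N′` given as `M·N = N′`** (v2, append-only) — the index shape of
abc-iut-L2-t4's tower fields `α β : ∀ {N N′}, N ∣ N′ → …` (there `R N′ : S.NthRoot f P N′` for an arbitrary multiple `N′`).
[cite: MochizukiEtTh2009, Rmk 4.3.2 p.318–319 (PDF pp.92–93)] -/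
theorem exists_rootTransition_of_nthRoots_of_mul_eq_mkOfModelCanonical
    {A B : tf.category} {f : tf.biratUnitsModel A}
    {P : (mkOfModelCanonical X tf hZ hP IG gS gSs NH A₀ hA₀ hA₀').FractionPair f B} {N N' : ℕ+}
    (R : (mkOfModelCanonical X tf hZ hP IG gS gSs NH A₀ hA₀ hA₀').NthRoot f P N (fun {_} φ x => tf.pullFracModel φ x))
    (R' : (mkOfModelCanonical X tf hZ hP IG gS gSs NH A₀ hA₀ hA₀').NthRoot f P N' (fun {_} φ x => tf.pullFracModel φ x))
    (M : ℕ+) (hM : M * N = N')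
    (φ : R'.AN ⟶ R.AN) (hφ : PreFrobenioid.IsPullbackMorphism tf.toElem φ)
    (hb : ModelFrobenioid.baseMap R'.αData.α₁ = ModelFrobenioid.baseMap φ ≫ ModelFrobenioid.baseMap R.αData.α₁)
    (hg : R'.root ^ (M : ℕ) = tf.pullFracModel φ R.root)
    (hsk : Nonempty (R'.AN.base ≅ R.AN.base) → R'.AN = R.AN) :
    ∃ (α : R'.AN ⟶ R.AN) (β : R'.BN ⟶ R.BN),
      R'.pair.num ≫ β = α ≫ R.pair.num ∧ R'.pair.den ≫ β = α ≫ R.pair.den ∧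
        (mkOfModelCanonical X tf hZ hP IG gS gSs NH A₀ hA₀ hA₀').IsIsometry α ∧
          ((mkOfModelCanonical X tf hZ hP IG gS gSs NH A₀ hA₀ hA₀').degFr α : ℕ) * N = N' ∧
            (mkOfModelCanonical X tf hZ hP IG gS gSs NH A₀ hA₀ hA₀').IsIsometry β ∧
              ((mkOfModelCanonical X tf hZ hP IG gS gSs NH A₀ hA₀ hA₀').degFr β : ℕ) * N = N' ∧
                (mkOfModelCanonical X tf hZ hP IG gS gSs NH A₀ hA₀ hA₀').IsOfBaseFrobeniusType α ∧
                  ModelFrobenioid.baseMap α = ModelFrobenioid.baseMap φ := by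
  subst hM
  have h := exists_rootTransition_of_nthRoots_mkOfModelCanonical X tf hZ hP IG gS gSs NH A₀ hA₀ hA₀' hΦd R R' φ hφ hb
    hg hsk
  simpa only [PNat.mul_coe] using h

end Canonical

end BiKummerSetting

end Literature.AnabelianGeometry.EtaleTheta

end
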